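import Summits.Ventures.YMGap.Thresholds.StarCount
import Summits.Ventures.YMGap.Thresholds.StarColumn
import HarnessLib

/-!
# Venture YMGap — track (c) «DS», brick B4b (i): the ARRAY of Lemma G on the torus star, its support,
# and the received sum `Σ_y K(s; y → x) = R_G(β)` ((H2) of the star door)

HONEST FRAMING: venture file (cell `pub-ymgap`, PLAN R95/R96 K-row), strong-coupling LATTICE
bookkeeping; finite combinatorics of the discrete torus `(ℤ/L)^4` and real arithmetic, NO measure,
NO estimate of a kernel, nothing about the continuum or the mass gap.

Contents (`s` a site, `⋆ = vertexStar s`, `c = β_W/4`):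
* `label s x : Fin 4 × Bool` — (direction, outgoing?) of a star link, the inverse of p3's
  `StarKernel.starLink s` on `⋆` (`label_starLink`, `starLink_label`, `label_eq_iff`, `eq_of_label_eq`);
* `kside c s a b x = [x ≠ a] · D^{(a)}(x; b)` (`StarColumn.Dpos` in coordinates) — the one-sided array
  of Lemma G with the gauge fixed at the star link `a`, partner `b`;
* `Karr c s y x = (c/2) Σ_{q ∋ y star plaquette} Σ_{(a,b) ∈ starPairsOf s q} kside c s a b x` for
  `x ∈ ⋆`, `y ∉ ⋆` (else `0`) — THE ARRAY (`GAUGE-STAR.md` §4, `B4-BLUEPRINT.md` §2); `Karr_nonneg`,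
  `Karr_eq_zero_of_not_mem_starBoundary`, `Karr_loc` (the support condition `hKloc` of the door);
* `sum_Karr_eq_gaugeR` — **(H2) as an equality**: `Σ_y Karr (β/4) s y x = gaugeR β` for `x ∈ ⋆`,
  `0 ≤ β ≤ 7/10`, side `≥ 3` (two boundary links per star plaquette, p3's regrouping
  `sum_starPlaqs_pairs'`, coordinates, `StarColumn.received_sum_eq_gaugeR`);
* `dvec c s y a b` — the super-solution vector `𝟙_y + c · kside` used by the comparison step
  (`StarLemmaGSuperSolution`, `StarWindowBoundLemmaG`), `dvec_nonneg`.

References: cell files `GAUGE-STAR.md` (ds-2), `B4-BLUEPRINT.md` (ds-4), `LEAN-KROW.md` (ds-1).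
-/

noncomputable section

open MeasureTheory Function Finset
open Literature.Probability.LatticeModels
open Literature.Probability.LatticeModels.DobrushinMetric
open Literature.MathematicalPhysics.QuantumFieldTheory
open Literature.MathematicalPhysics.QuantumFieldTheory.Balaban1983to89.StrongCouplingTorusWindow
open Summit.Ventures.YMGap.DSWindow
open Summit.Ventures.YMGap.StarKernel
open Summit.Ventures.YMGap.StarColumn
open Summit.Ventures.YMGap.StarWindowGauge (gaugeR)

namespace Summit.Ventures.YMGap.StarLemmaG

variable {L : ℕ} [NeZero L]

/-! ### Coordinates on the vertex star: the label `(direction, outgoing?)` of a star link -/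

/-- The abstract label of a link relative to the vertex `s`: its direction and whether it is the
OUTGOING star link `(s, μ)` (`true`) — the inverse of `StarKernel.starLink s` on the vertex star.
[folklore] -/
def label (s : Site 4 L) (x : Edge 4 L) : Dir :=
  (x.2, decide (x.1 = s))

omit [NeZero L] in
/-- The first component of the label is the direction. [folklore] -/
@[simp] theorem label_fst (s : Site 4 L) (x : Edge 4 L) : (label s x).1 = x.2 := rfl

omit [NeZero L] in
/-- `label ∘ starLink = id` (torus of side `≥ 2`). [folklore] -/
theorem label_starLink (hL : 1 < L) (s : Site 4 L) (μ : Fin 4) (o : Bool) :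
    label s (starLink s μ o) = (μ, o) := by
  cases o
  · have h : s - Pi.single μ 1 ≠ s := fun h => single_ne_zero' hL μ (sub_eq_self.1 h)
    simp [label, starLink, h]
  · simp [label, starLink]

/-- `starLink ∘ label = id` on the vertex star. [folklore] -/
theorem starLink_label (hL : 1 < L) {s : Site 4 L} {x : Edge 4 L} (hx : x ∈ vertexStar s) :
    starLink s (label s x).1 (label s x).2 = x := by
  obtain ⟨o, h⟩ := eq_starLink_of_mem_vertexStar hx
  have hl : label s x = (x.2, o) := by
    conv_lhs => rw [h]
    exact label_starLink hL s x.2 o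
  rw [hl]
  exact h.symm

/-- A star link has label `α` iff it is `starLink s α.1 α.2`. [folklore] -/
theorem label_eq_iff (hL : 1 < L) {s : Site 4 L} {x : Edge 4 L} (hx : x ∈ vertexStar s) (α : Dir) :
    label s x = α ↔ x = starLink s α.1 α.2 := by
  constructor
  · rintro rfl
    exact (starLink_label hL hx).symm
  · rintro rfl
    exact label_starLink hL s α.1 α.2

/-- `label s` is injective on the vertex star. [folklore] -/
theorem eq_of_label_eq (hL : 1 < L) {s : Site 4 L} {x z : Edge 4 L} (hx : x ∈ vertexStar s)
    (hz : z ∈ vertexStar s) (h : label s x = label s z) : x = z := by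
  rw [← starLink_label hL hx, ← starLink_label hL hz, h]

/-! ### The array of Lemma G -/

/-- **One-sided array** (gauge fixed at the star link `a`, partner `b`): `0` at `a`, and the resolvent
entry `D^{(a)}(x; b)` by position elsewhere (`StarColumn.Dpos` in coordinates). [folklore] -/
def kside (c : ℝ) (s : Site 4 L) (a b x : Edge 4 L) : ℝ :=
  if x = a then 0 else Dpos c (label s a) (label s b) (label s x)

omit [NeZero L] in
/-- The one-sided array is nonnegative for `0 ≤ c ≤ 7/40`. [folklore] -/
theorem kside_nonneg {c : ℝ} (h0 : 0 ≤ c) (h1 : c ≤ 7 / 40) (s : Site 4 L) (a b x : Edge 4 L) :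
    0 ≤ kside c s a b x := by
  unfold kside
  split_ifs
  · exact le_rfl
  · exact Dpos_nonneg h0 h1 _ _ _

/-- **THE ARRAY of Lemma G** (`GAUGE-STAR.md` §4, `B4-BLUEPRINT.md` §2): for a star link `x` and a
link `y` off the star, `K(s; y → x) = (c/2) · Σ` over the star plaquettes `q ∋ y` and the ordered pairs
`(a, b)` of star links of `q` of the one-sided entries `kside c s a b x` (the average of the two gauge
fixings `a` and `b`); `0` otherwise. For `y` on the star boundary the plaquette is unique and the sum
has the two terms `(a,b), (b,a)`. [folklore] -/
def Karr (c : ℝ) (s : Site 4 L) (y x : Edge 4 L) : ℝ :=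
  if x ∈ vertexStar s ∧ y ∉ vertexStar s then
    (c / 2) * ∑ q ∈ (starPlaqs s).filter (fun q => y ∈ plaqEdgesT q),
      ∑ ab ∈ starPairsOf s q, kside c s ab.1 ab.2 x
  else 0

/-- The array is nonnegative for `0 ≤ c ≤ 7/40`. [folklore] -/
theorem Karr_nonneg {c : ℝ} (h0 : 0 ≤ c) (h1 : c ≤ 7 / 40) (s : Site 4 L) (y x : Edge 4 L) :
    0 ≤ Karr c s y x := by
  unfold Karr
  split_ifs
  · exact mul_nonneg (by linarith) (sum_nonneg fun q _ => sum_nonneg fun ab _ =>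
      kside_nonneg h0 h1 s _ _ _)
  · exact le_rfl

/-- The array vanishes unless `y` lies on the star boundary. [folklore] -/
theorem Karr_eq_zero_of_not_mem_starBoundary {c : ℝ} {s : Site 4 L} {y : Edge 4 L}
    (hy : y ∉ starBoundary s) (x : Edge 4 L) : Karr c s y x = 0 := by
  unfold Karr
  split_ifs with h
  · have hempty : (starPlaqs s).filter (fun q => y ∈ plaqEdgesT q) = ∅ := by
      refine filter_eq_empty_iff.2 fun q hq hyq => hy (mem_starBoundary.2 ⟨⟨q, hq, hyq⟩, h.2⟩)
    rw [hempty, sum_empty, mul_zero]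
  · rfl

/-- **Support (hKloc of the star door)**: a nonzero entry forces `y` onto the star boundary, whose
links have both endpoints at sup-distance `≤ 1` from `s`. [folklore] -/
theorem Karr_loc {c : ℝ} (s : Site 4 L) (y x : Edge 4 L) (h : Karr c s y x ≠ 0) :
    ∀ w ∈ linkEnds y, torusNorm (s - w) ≤ 1 := by
  intro w hw
  by_cases hy : y ∈ starBoundary s
  · exact torusNorm_le_one_of_mem_starBoundary hy hw
  · exact absurd (Karr_eq_zero_of_not_mem_starBoundary hy x) h

/-! ### (H2): the received sum of the array is `R_G(β)` -/

/-- The pair sum of the one-sided arrays in coordinates: for a star link `x` with label `ξ`,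
`Σ_{a ∈ ⋆} Σ_{b ∈ ⋆, b.2 ≠ a.2} kside c s a b x = Σ_{(α,β) ∈ pairSet ξ} Dpos c α β ξ`. [folklore] -/
theorem sum_pairs_kside (hL : 1 < L) (c : ℝ) {s : Site 4 L} {x : Edge 4 L} (hx : x ∈ vertexStar s) :
    ∑ a ∈ vertexStar s, ∑ b ∈ (vertexStar s).filter (fun b => b.2 ≠ a.2), kside c s a b x =
      ∑ p ∈ pairSet (label s x), Dpos c p.1 p.2 (label s x) := by
  -- inner and outer sums in coordinates
  have inner : ∀ a ∈ vertexStar s,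
      ∑ b ∈ (vertexStar s).filter (fun b => b.2 ≠ a.2), kside c s a b x =
        ∑ β : Dir, if β.1 ≠ a.2 then kside c s a (starLink s β.1 β.2) x else 0 := by
    intro a _
    rw [sum_filter, sum_vertexStar_eq_sum_starLink hL s]
    rfl
  rw [sum_congr rfl inner, sum_vertexStar_eq_sum_starLink hL s]
  simp only [starLink_snd]
  rw [pairSet, sum_filter]
  conv_rhs => rw [Fintype.sum_prod_type]
  apply sum_congr rfl
  intro α _
  apply sum_congr rfl
  intro β _
  have hk : kside c s (starLink s α.1 α.2) (starLink s β.1 β.2) x =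
      if label s x = α then 0 else Dpos c α β (label s x) := by
    unfold kside
    rw [label_starLink hL, label_starLink hL]
    by_cases h : label s x = α
    · rw [if_pos h, if_pos ((label_eq_iff hL hx α).1 h)]
    · rw [if_neg h, if_neg (fun h' => h ((label_eq_iff hL hx α).2 h'))]
  rw [hk]
  by_cases h1 : β.1 ≠ α.1
  · by_cases h2 : label s x = α
    · rw [if_pos h1, if_pos h2, if_neg (fun h => h.2 h2.symm)]
    · rw [if_pos h1, if_neg h2, if_pos ⟨fun h => h1 h.symm, fun h => h2 h.symm⟩]
  · rw [if_neg h1, if_neg (fun h => h1 (fun h' => h.1 h'.symm))]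

/-- **(H2) for the Lemma-G array**: for `0 ≤ β ≤ 7/10`, side `≥ 3`, every star link `x` of `s`
receives exactly `Σ_y K(s; y → x) = R_G(β)` (`StarWindowGauge.gaugeR`; each star plaquette has two
boundary links, the regrouping `StarKernel.sum_starPlaqs_pairs'`, and the count
`StarColumn.received_sum_eq_gaugeR`). [folklore] -/
theorem sum_Karr_eq_gaugeR (hL : 3 ≤ L) {β : ℝ} (h0 : 0 ≤ β) (h1 : β ≤ 7 / 10) {s : Site 4 L}
    {x : Edge 4 L} (hx : x ∈ vertexStar s) : ∑ y : Edge 4 L, Karr (β / 4) s y x = gaugeR β := by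
  have hL1 : 1 < L := by omega
  set g : Plaquette 4 L → ℝ := fun q => ∑ ab ∈ starPairsOf s q, kside (β / 4) s ab.1 ab.2 x with hg
  -- Step A: unfold the array as an indicator sum over all star plaquettes
  have stepA : ∀ y, Karr (β / 4) s y x =
      (β / 4 / 2) * ∑ q ∈ starPlaqs s, (if y ∈ plaqEdgesT q ∧ y ∉ vertexStar s then g q else 0) := by
    intro y
    unfold Karr
    by_cases hy : y ∈ vertexStar s
    · rw [if_neg (fun h => h.2 hy), sum_congr rfl (fun q _ => if_neg (fun h => h.2 hy))]
      simp
    · rw [if_pos ⟨hx, hy⟩, sum_filter]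
      congr 1
      refine sum_congr rfl fun q _ => ?_
      simp [hy, hg]
  -- Step B: swap the sums; each star plaquette has exactly two boundary links
  have stepB : ∑ y : Edge 4 L, Karr (β / 4) s y x = (β / 4) * ∑ q ∈ starPlaqs s, g q := by
    simp_rw [stepA]
    rw [← mul_sum, sum_comm]
    have h2 : ∀ q ∈ starPlaqs s,
        ∑ y : Edge 4 L, (if y ∈ plaqEdgesT q ∧ y ∉ vertexStar s then g q else 0) = 2 * g q := by
      intro q hq
      rw [← sum_filter, sum_const, nsmul_eq_mul]
      have hset : (univ.filter fun y : Edge 4 L => y ∈ plaqEdgesT q ∧ y ∉ vertexStar s) =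
          (plaqEdgesT q).filter (fun e => e ∉ vertexStar s) := by
        ext y; simp [mem_filter]
      rw [hset, card_filter_not_mem_vertexStar hL1 hq]
      norm_num
    rw [sum_congr rfl h2, ← mul_sum]
    ring
  -- Step C: regroup over ordered non-opposite pairs, pass to coordinates, count
  rw [stepB, hg, sum_starPlaqs_pairs' hL s (fun a b => kside (β / 4) s a b x),
    sum_pairs_kside hL1 (β / 4) hx, received_sum_eq_gaugeR h0 h1]

/-- **The super-solution vector** of the one-sided comparison (gauge fixed at `a`, perturbed boundary
link `y` on the star plaquette through `a, b`): `1` at `y`, `c · kside` on the star, `0` elsewhere.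
[folklore] -/
def dvec (c : ℝ) (s : Site 4 L) (y a b z : Edge 4 L) : ℝ :=
  if z = y then 1 else c * (if z ∈ vertexStar s then kside c s a b z else 0)

/-- `dvec ≥ 0` for `0 ≤ c ≤ 7/40`. [folklore] -/
theorem dvec_nonneg {c : ℝ} (h0 : 0 ≤ c) (h1 : c ≤ 7 / 40) (s : Site 4 L) (y a b z : Edge 4 L) :
    0 ≤ dvec c s y a b z := by
  unfold dvec
  split_ifs
  · exact zero_le_one
  · exact mul_nonneg h0 (kside_nonneg h0 h1 s a b z)
  · simp


end Summit.Ventures.YMGap.StarLemmaG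

end
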